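import Mathlib
import HarnessLib
import Literature.MathematicalPhysics.KineticTheory.HardSphereEuler
import Literature.MathematicalPhysics.KineticTheory.BackwardCluster

/-!
# Stub `stub_chainOfMember` of the line `Sketch` (log-window-tagged-tail) for the crux
`RelayRaceLocality.GibbsLightCone` (stmt-AtomisticToContinuum-12501)

Registered stub of the lead prover's reshaped skeleton (`Cruxes/GibbsLightCone/Lines/Sketch.lean`,
revision 4): CHAIN OF A MEMBER — the deterministic characterisation (necessity direction) of the
APST backward cluster (`Literature.MathematicalPhysics.KineticTheory.backwardCluster`, built by the
backward `sweep` over the collision events of the window): on the good set of a hard-sphere flow on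
`𝕋³`, every member `j` of the backward cluster of `i` over `(s, t]` is joined to `i` by a STRICTLY
time-ordered collision chain inside the window — particles `q 0 = j, q 1, …, q k = i` and times
`τ 0 < τ 1 < ⋯ < τ (k-1)` in `(s, t]` with the pair `{q m, q (m+1)}` in contact at time `τ m`
(Aoki–Pulvirenti–Simonella–Tsuji 2015 §1, §5: "going back in time … the first particle colliding
with `i` joins, then the first new particle colliding with one of the group, …").

Proof: induction over the increasing list of collision times of the window (`Finset.sort`): the
sweep processes the earliest event last (`sweep_cons`), and a particle enters at the step of time
`a` iff it is the partner, in the event at time `a`, of a particle already swept in from the later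
events (`mem_clusterStep`); prepend that link (`Fin.cons`) to the chain of the partner, whose times
all exceed `a` because the list is strictly increasing. Holds for an arbitrary curve (no trajectory
hypothesis): `chainOfMember_of_mem_sweep`, `chainOfMember_of_mem_backwardCluster`; the converse
`mem_sweep_of_chain` and the characterisations `mem_backwardCluster_iff_exists_chain` (curve,
finitely many collision times in the window) / `flow_mem_backwardCluster_iff_exists_chain` (good set
of a flow) complete the picture.
-/

namespace Summit.AtomisticToContinuum.HydrodynamicLimit.Theorems.LogWindowTaggedTail

open Literature.MathematicalPhysics.KineticTheory Literature.Analysis.FluidPDE MeasureTheory Filter Set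

/-- Prepending a time below all times of a strictly increasing tuple keeps it strictly increasing.
[folklore] -/
theorem chainOfMember_strictMono_cons :
    ∀ {k : ℕ} {a : ℝ} {τ : Fin k → ℝ}, StrictMono τ → (∀ m, a < τ m) →
      StrictMono (Fin.cons a τ : Fin (k + 1) → ℝ)
  | 0, _, _, _, _ => fun m m' h => absurd (Fin.subsingleton_one.elim m m') (ne_of_lt h)
  | _ + 1, _, _, hτ, ha => by
    refine Fin.strictMono_iff_lt_succ.2 fun m => ?_
    rw [Fin.cons_succ]
    refine Fin.cases ?_ (fun m' => ?_) m
    · simpa using ha 0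
    · rw [← Fin.succ_castSucc, Fin.cons_succ]
      exact hτ (Fin.castSucc_lt_succ (i := m'))

/-- CHAIN OF A MEMBER, list level (arbitrary curve `γ`, arbitrary strictly increasing list `L` of
times): every particle other than `i` swept into the running cluster of `i` by the backward sweep over
the events of `γ` at the times of `L` is joined to `i` by a strictly time-ordered chain of contacts at
times taken from `L`. [folklore] -/
theorem chainOfMember_of_mem_sweep {N : ℕ} (ε : ℝ) (γ : ℝ → Config N (Fin 3) T3) (i : Fin N) :
    ∀ (L : List ℝ), L.Pairwise (· < ·) → ∀ x : Fin N,
      x ∈ (sweep (L.map fun τ => contactPairSet (Torus.geometry (Fin 3)) ε (γ τ)) ({i}, 0)).1 →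
      x ≠ i →
      ∃ (k : ℕ) (q : Fin (k + 1) → Fin N) (τ : Fin k → ℝ),
        q 0 = x ∧ q (Fin.last k) = i ∧ StrictMono τ ∧ (∀ m, τ m ∈ L) ∧
        ∀ m : Fin k, s(q (Fin.castSucc m), q (Fin.succ m)) ∈
          contactPairSet (Torus.geometry (Fin 3)) ε (γ (τ m)) := by
  intro L
  induction L with
  | nil =>
    intro _ x hx hxi
    simp only [List.map_nil, sweep_nil, Finset.mem_singleton] at hx
    exact absurd hx hxi
  | cons a L ih =>
    intro hL x hx hxi
    rw [List.pairwise_cons] at hL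
    obtain ⟨haL, hL'⟩ := hL
    rw [List.map_cons, sweep_cons] at hx
    change x ∈ clusterStep _ (sweep (L.map fun τ => contactPairSet (Torus.geometry (Fin 3)) ε (γ τ))
      ({i}, 0)).1 at hx
    rcases mem_clusterStep.1 hx with hxS | ⟨j, hjS, hjx⟩
    · -- already swept in from the later events
      obtain ⟨k, q, τ, hq0, hqk, hmono, hmem, hlink⟩ := ih hL' x hxS hxi
      exact ⟨k, q, τ, hq0, hqk, hmono, fun m => List.mem_cons_of_mem a (hmem m), hlink⟩
    · -- `x` enters at time `a` as the partner of the swept-in particle `j`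
      have hxj : s(x, j) ∈ contactPairSet (Torus.geometry (Fin 3)) ε (γ a) := by
        rw [Sym2.eq_swap]; exact hjx
      by_cases hji : j = i
      · subst hji
        refine ⟨1, Fin.cons x fun _ => j, fun _ => a, rfl, rfl, ?_, fun _ => List.mem_cons_self,
          fun m => ?_⟩
        · intro m m' h
          exact absurd (Subsingleton.elim m m') (ne_of_lt h)
        · have hm : m = 0 := Subsingleton.elim m 0
          subst hm
          simpa using hxj
      · obtain ⟨k, q, τ, hq0, hqk, hmono, hmem, hlink⟩ := ih hL' j hjS hji
        have haτ : ∀ m, a < τ m := fun m => haL _ (hmem m)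
        refine ⟨k + 1, Fin.cons x q, Fin.cons a τ, rfl, ?_, chainOfMember_strictMono_cons hmono haτ,
          fun m => ?_, fun m => ?_⟩
        · rw [← Fin.succ_last, Fin.cons_succ]
          exact hqk
        · refine Fin.cases ?_ (fun m' => ?_) m
          · exact List.mem_cons_self
          · rw [Fin.cons_succ]
            exact List.mem_cons_of_mem a (hmem m')
        · refine Fin.cases ?_ (fun m' => ?_) m
          · simpa [hq0] using hxj
          · rw [Fin.cons_succ, ← Fin.succ_castSucc, Fin.cons_succ, Fin.cons_succ]
            exact hlink m'

/-- CHAIN OF A MEMBER, curve level: every member of `backwardCluster G ε γ i s t` (arbitrary curve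
`γ` on `𝕋³`) is joined to `i` by a strictly time-ordered chain of contacts at collision times of the
window `(s, t]`. [folklore] -/
theorem chainOfMember_of_mem_backwardCluster {N : ℕ} (ε : ℝ) (γ : ℝ → Config N (Fin 3) T3)
    (i j : Fin N) (s t : ℝ)
    (hj : j ∈ backwardCluster (Torus.geometry (Fin 3)) ε γ i s t) :
    ∃ (k : ℕ) (q : Fin (k + 1) → Fin N) (τ : Fin k → ℝ),
      q 0 = j ∧ q (Fin.last k) = i ∧ StrictMono τ ∧ (∀ m, τ m ∈ Set.Ioc s t) ∧
      ∀ m : Fin k, s(q (Fin.castSucc m), q (Fin.succ m)) ∈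
        contactPairSet (Torus.geometry (Fin 3)) ε (γ (τ m)) := by
  obtain ⟨hji, hjS⟩ := mem_backwardCluster_iff.1 hj
  have hsort : ((collisionWindow (Torus.geometry (Fin 3)) ε γ s t).sort).Pairwise (· < ·) :=
    List.sortedLT_iff_pairwise.1 (Finset.sortedLT_sort _)
  obtain ⟨k, q, τ, hq0, hqk, hmono, hmem, hlink⟩ :=
    chainOfMember_of_mem_sweep ε γ i _ hsort j hjS hji
  refine ⟨k, q, τ, hq0, hqk, hmono, fun m => ?_, hlink⟩
  exact (mem_of_mem_collisionWindow ((Finset.mem_sort _).1 (hmem m))).2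

/-! ## The converse: a chain of contacts at listed times sweeps its first particle in -/

/-- MEMBER OF A CHAIN, list level (converse of `chainOfMember_of_mem_sweep`): if the particles
`q 0, …, q k` are linked by contacts at strictly increasing times `τ 0 < ⋯ < τ (k-1)` all taken from
the strictly increasing list `L`, with `q k = i`, then `q 0` is swept into the running cluster of `i`
by the backward sweep over the events at the times of `L`. [folklore] -/
theorem mem_sweep_of_chain {N : ℕ} (ε : ℝ) (γ : ℝ → Config N (Fin 3) T3) (i : Fin N) :
    ∀ (L : List ℝ), L.Pairwise (· < ·) → ∀ (k : ℕ) (q : Fin (k + 1) → Fin N) (τ : Fin k → ℝ),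
      q (Fin.last k) = i → StrictMono τ → (∀ m, τ m ∈ L) →
      (∀ m : Fin k, s(q (Fin.castSucc m), q (Fin.succ m)) ∈
        contactPairSet (Torus.geometry (Fin 3)) ε (γ (τ m))) →
      q 0 ∈ (sweep (L.map fun τ => contactPairSet (Torus.geometry (Fin 3)) ε (γ τ)) ({i}, 0)).1 := by
  intro L
  induction L with
  | nil =>
    intro _ k q τ hqk _ hmem _
    cases k with
    | zero => simpa [sweep_nil] using hqk
    | succ k => exact absurd (hmem 0) List.not_mem_nil
  | cons a L ih =>
    intro hL k
    rw [List.pairwise_cons] at hL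
    obtain ⟨haL, hL'⟩ := hL
    induction k with
    | zero =>
      intro q τ hqk _ _ _
      refine fst_subset_sweep_fst _ _ ?_
      simpa using hqk
    | succ k _ =>
      intro q τ hqk hmono hmem hlink
      rw [List.map_cons, sweep_cons]
      change q 0 ∈ clusterStep _
        (sweep (L.map fun τ => contactPairSet (Torus.geometry (Fin 3)) ε (γ τ)) ({i}, 0)).1
      -- the tail chain `q 1, …, q (k+1)` with times `τ 1 < ⋯` lies in `L`
      have htailL : ∀ m : Fin k, τ (Fin.succ m) ∈ L := by
        intro m
        have hlt : τ 0 < τ (Fin.succ m) := hmono (Fin.succ_pos m)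
        rcases List.mem_cons.1 (hmem (Fin.succ m)) with h | h
        · -- `τ (m+1) = a` is impossible: `a ≤ τ 0 < τ (m+1)`
          exfalso
          rcases List.mem_cons.1 (hmem 0) with h0 | h0
          · rw [h, h0] at hlt; exact lt_irrefl _ hlt
          · rw [h] at hlt; exact lt_asymm hlt (haL _ h0)
        · exact h
      have htail : q (Fin.succ 0) ∈
          (sweep (L.map fun τ => contactPairSet (Torus.geometry (Fin 3)) ε (γ τ)) ({i}, 0)).1 :=
        ih hL' k (fun m => q (Fin.succ m)) (fun m => τ (Fin.succ m))
          (by rw [Fin.succ_last]; exact hqk)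
          (fun m₁ m₂ h => hmono (Fin.succ_lt_succ_iff.2 h)) htailL
          (fun m => by rw [Fin.succ_castSucc]; exact hlink (Fin.succ m))
      rcases List.mem_cons.1 (hmem 0) with h0 | h0
      · -- the first link happens at time `a`: `q 0` is the partner of `q 1` in the event at `a`
        refine mem_clusterStep.2 (Or.inr ⟨q (Fin.succ 0), htail, ?_⟩)
        rw [Sym2.eq_swap, ← h0]
        simpa using hlink 0
      · -- all links lie in `L`: the whole chain is swept in from the later events
        refine subset_clusterStep _ _ (ih hL' (k + 1) q τ hqk hmono (fun m => ?_) hlink)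
        refine Fin.cases h0 (fun m' => htailL m') m

/-- CHARACTERISATION OF THE BACKWARD CLUSTER BY COLLISION CHAINS (arbitrary curve `γ` on `𝕋³` with
finitely many collision times in the window): `j` belongs to the backward cluster of `i` over
`(s, t]` iff `j ≠ i` and some strictly time-ordered chain of contacts at collision times of the
window joins `j` to `i` (APST 2015 §5). [cite: AokiPulvirentiSimonellaTsuji2015, §5] -/
theorem mem_backwardCluster_iff_exists_chain {N : ℕ} (ε : ℝ) (γ : ℝ → Config N (Fin 3) T3)
    (i j : Fin N) (s t : ℝ)
    (hfin : (collisionTimes (Torus.geometry (Fin 3)) ε γ ∩ Set.Ioc s t).Finite) :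
    j ∈ backwardCluster (Torus.geometry (Fin 3)) ε γ i s t ↔
      j ≠ i ∧ ∃ (k : ℕ) (q : Fin (k + 1) → Fin N) (τ : Fin k → ℝ),
        q 0 = j ∧ q (Fin.last k) = i ∧ StrictMono τ ∧ (∀ m, τ m ∈ Set.Ioc s t) ∧
        ∀ m : Fin k, s(q (Fin.castSucc m), q (Fin.succ m)) ∈
          contactPairSet (Torus.geometry (Fin 3)) ε (γ (τ m)) := by
  constructor
  · intro hj
    exact ⟨(mem_backwardCluster_iff.1 hj).1, chainOfMember_of_mem_backwardCluster ε γ i j s t hj⟩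
  · rintro ⟨hji, k, q, τ, hq0, hqk, hmono, hwin, hlink⟩
    refine mem_backwardCluster_iff.2 ⟨hji, ?_⟩
    have hsort : ((collisionWindow (Torus.geometry (Fin 3)) ε γ s t).sort).Pairwise (· < ·) :=
      List.sortedLT_iff_pairwise.1 (Finset.sortedLT_sort _)
    have hmem : ∀ m, τ m ∈ (collisionWindow (Torus.geometry (Fin 3)) ε γ s t).sort := by
      intro m
      rw [Finset.mem_sort, mem_collisionWindow hfin]
      refine ⟨mem_collisionTimes_iff_contactPairSet_nonempty.2 ⟨_, hlink m⟩, hwin m⟩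
    rw [← hq0]
    exact mem_sweep_of_chain ε γ i _ hsort k q τ hqk hmono hmem hlink

/-- CHARACTERISATION along a hard-sphere flow (good set): `j ∈ Φ.backwardCluster i s t z` iff
`j ≠ i` and a strictly time-ordered collision chain inside `(s, t]` joins `j` to `i` along the orbit
of `z`. [folklore] -/
theorem flow_mem_backwardCluster_iff_exists_chain
    {N : ℕ} {ε : ℝ} (Φ : HardSphereFlow (Torus.geometry (Fin 3)) ε N) {z : Config N (Fin 3) T3}
    (hz : z ∈ Φ.good) (i j : Fin N) (s t : ℝ) :
    j ∈ Φ.backwardCluster i s t z ↔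
      j ≠ i ∧ ∃ (k : ℕ) (q : Fin (k + 1) → Fin N) (τ : Fin k → ℝ),
        q 0 = j ∧ q (Fin.last k) = i ∧ StrictMono τ ∧ (∀ m, τ m ∈ Set.Ioc s t) ∧
        ∀ m : Fin k, s(q (Fin.castSucc m), q (Fin.succ m)) ∈
          contactPairSet (Torus.geometry (Fin 3)) ε (Φ.flow (τ m) z) := by
  rw [Φ.backwardCluster_apply hz]
  exact mem_backwardCluster_iff_exists_chain ε (fun τ => Φ.flow τ z) i j s t
    (((Φ.isTrajectory z hz).locFinite s t).subset
      (Set.inter_subset_inter_right _ Set.Ioc_subset_Icc_self))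

/-- CHAIN OF A MEMBER (registered stub `stub_chainOfMember` of the line `Sketch` for the crux
`GibbsLightCone`, stmt-AtomisticToContinuum-12501; deterministic): on the good set, every member `j`
of the backward cluster of `i` over `(s, t]` is joined to `i` by a strictly time-ordered collision
chain inside the window: particles `q 0 = j, q 1, …, q k = i` (`k ≥ 1` links) and times
`s < τ 0 < τ 1 < ⋯ < τ (k-1) ≤ t` with the pair `{q m, q (m+1)}` in contact at time `τ m`
(APST 2015 §1/§5: the cluster is built from time-ordered collision sequences). [folklore] -/
theorem stub_chainOfMember :
    ∀ (N : ℕ) (ε : ℝ) (Φ : HardSphereFlow (Torus.geometry (Fin 3)) ε N) (z : Config N (Fin 3) T3),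
    z ∈ Φ.good → ∀ (i j : Fin N) (s t : ℝ), j ∈ Φ.backwardCluster i s t z →
      ∃ (k : ℕ) (q : Fin (k + 1) → Fin N) (τ : Fin k → ℝ),
        q 0 = j ∧ q (Fin.last k) = i ∧ StrictMono τ ∧ (∀ m, τ m ∈ Set.Ioc s t) ∧
        ∀ m : Fin k, s(q (Fin.castSucc m), q (Fin.succ m)) ∈
          contactPairSet (Torus.geometry (Fin 3)) ε (Φ.flow (τ m) z) := by
  intro N ε Φ z hz i j s t hj
  rw [Φ.backwardCluster_apply hz] at hj
  exact chainOfMember_of_mem_backwardCluster ε (fun τ => Φ.flow τ z) i j s t hj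

end Summit.AtomisticToContinuum.HydrodynamicLimit.Theorems.LogWindowTaggedTail
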